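import Summits.QuantumFields.YangMills.Theorems.BalabanUVNodesN18CornerBandOfKernelLetters
import Summits.QuantumFields.YangMills.Theorems.BalabanUVNodesN18RemainderBandOfKernelLetters

/-!
# BalabanUVNodes ∕ N18 — THE CORNER OF THE U3 → U2 FACE, FILE 2: the EDITIONS of FILE 1's v₀-free corner band (`…N18CornerBandOfKernelLetters`) at def-W1's kernel objects,
# AT THE STAGE-13 RECORD from K3⁷ v5 §2b (i)∕(iii)'s raw kernel inputs WITHOUT the admissibility row `hadm`, at K3⁷∕K4's node-U3 carriers (`ReadOutAt ∧ N22At`) and at the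
# bundle of record; plus the K1⁷ run-rows OFFER in generic currency
# (Track A, DAG node N18 = NE5, in-edge to N17 = node U3 → node U2; key K3⁷ `SpineGivenEndpointR13SepCoPH` = stmt-QuantumFields-20544, skeleton v5 941dddb108cbaacf; width seat
# `pub-ymgap-dag-n18-w1` g4; split from FILE 1 by the 400-line rule — one topic, two files)

HONEST FRAMING.  Count-neutral kernel bookkeeping BY NAME (`--kind proof --supports stmt-QuantumFields-20544 --as helper`): FILE 1's real-analysis lemmas composed with LANDED
lemmas of dag-n22-w3 (`histLipschitz_betaMerged_of_ne9`, `histLipschitz_betaOfRecord₁₃_of_kernelNE9`, `histLipschitz_fadingMemory_betaOfRecord₁₃_of_kernelNE9`,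
`fadingMemory_histModuli_of_fadingMemory`), dag-n17-w3 (`histLipschitz_of_readOutAt_n22`) and g3 (`beta0LimitExists_of_histLipschitz`, `tendsto_beta0OfMerged`).  Kernel NE9, the
(5.10) clause, `ReadOutAt`, `N22At`, fading memory, the ceiling and the corner floor of §5 are DISPLAYED HYPOTHESES — nothing of Bałaban's is asserted, inhabited or discharged; NO
corner sign, NO identification with named one-loop numbers, NO drift value claimed; N17 ∕ N18 ∕ N22 NOT discharged; K3⁷ OPEN (v5), `stub_rates13H` ∕ `stub_expansion13H` NOT
proved; K1⁷ ∕ K2⁷ served BY NAME only (nothing registered; DEF-1's `ScaleAnchor` ∕ `ConstRemainder` ∕ `RunConstRemainder` shapes spelled INLINE, δ-unfolding to the `def`s, so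
that nothing from the K2⁷ ∕ Theses cone is imported).  Counts UNMOVED (typed 28∕28 · discharged 5∕27, A 5∕28).  One finite four-torus programme at fixed `ε`, Bałaban AS
PRINTED; route R4 closes ONLY the conditional finite-𝕋⁴ rung `BalabanLadder.UV` — NOT the continuum limit, NOT ℝ⁴, NOT OS, NOT the Yang–Mills mass gap, NOT Clay.
THEOREMS ONLY: 0 `def`, 0 `instance`, 0 `sorry`, standard axioms.  Credit as in FILE 1 (PORT-1 p609637 ∕ idea-7 ∕ CRIT-2 ∕ an4 ∕ DEF-1 — cited, nothing re-declared).

WHAT (theorems only).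
* §2 generic term family (W1-19 objects `EA F ℰ ρ bV`, `betaMerged F ℰ ρ bV`): `betaPrime510_four_one_nonneg` · ★ `exists_cornerNumbers_betaMerged_of_ne9` (`0 < γ`, `0 < κ`,
  `NE9 (EA F ℰ ρ bV) (Window γ) κ Λ`, `KernelDecay … 0 1 κ` ⟹ corner numbers = diagonal limits + the band with moduli `betaPrime510 4 1 κ·|Λ (k+1) i|`) ·
  `abs_betaMerged_sub_corner_le_band_of_ne9_fadingMemory` (+ node U3's `FadingMemory C₉ ω Λ`, `ω < 1`: `r = betaPrime510 4 1 κ·C₉·ω·(1−ω)⁻¹·γ₀` on every `]0,γ₀]^{k+1}`, `γ₀ ≤ γ`).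
* §3 AT THE RECORD, Stage 13, from K3⁷ v5 §2b (i)∕(iii)'s `h9` ∕ `hdec` VERBATIM, NO `hadm`: ★★ `exists_cornerNumbers_betaOfRecord₁₃_of_kernelNE9` · ★★ `anchor_betaOfRecord₁₃_of_kernelNE9`
  (= the `hA` hypothesis of v5 §2b (ii′) `sensitive_rrOfRecord_of_pinned_of_anchor` ∕ §4 (iv) `betaOfRecord_eq_anchor_of_guardedReading_of_blind`, DISCHARGED from (i)+(iii) — NOT an
  extra letter under the pin) · `abs_betaOfRecord₁₃_sub_corner_le_band_of_kernelNE9_letters` (ℓ.Signs edition: `r = betaPrime510 4 1 ℓ.κ·ℓ.C₉·ℓ.ω·(1−ℓ.ω)⁻¹·γ₀`, k-uniform — DEF-1's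
  `ConstRemainder` relative to the CORNER numbers) · `abs_beta0OfMerged_record_sub_corner_le_of_kernelNE9_letters` (WITH `hadm`: the consumers' (2.12) numbers
  `beta0OfMerged β_m θ.v₀` — the `hlim` object, CRIT-2 p592695's exposed object — lie within `…·θ.γ` of the corner numbers; at `θ.v₀ := 0` they are junk and the corner numbers replace them).
* §4 K3⁷ ∕ K4 carriers (`ReadOutAt D u ∧ N22At u`, ANY carriers, N18 idle): ★★ `exists_cornerNumbers_βfun_of_readOutAt_n22` · `abs_βfun_sub_corner_le_band_of_readOutAt_n22` ·
  ★★ `exists_cornerNumbers_betaOfRecord₁₃_of_readOutAt_n22_rateCarriersOfRecord₁₃CoPH` (at K3⁷ v5's bundle of record `rrOfRecord 𝔯 ksel` at one tuple and run length: under stub 1's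
  (D4) ∧ N22 conjuncts the β OF RECORD is per-scale anchored at its corner numbers — K2⁷'s corner-road input `∃ b, ScaleAnchor …` and K3⁷ §4 (iv)'s `hA` come for free, NO `θ.v₀` read).
* §5 SERVED BY NAME, an OFFER in generic `HBeta` currency (nothing K1-side imported): `prefixOf_mem_histBox` · ★ `runRows_of_band_floor_ceiling` (a k-uniform corner band + a ceiling
  `β ≤ U < βup` + an eventual FLOOR `e > 0` of the corner numbers ⟹ the β-rows of K1⁷ v6 `stub_runRows13PWS` in BOX form with the corner numbers as reference sequence; run rows by
  DEF-1's `runConstRemainder_of_constRemainder`) — so at a rung-1 witness K1's β-rows reduce to {N22-type moduli, a β-ceiling below `w.βup`, the corner SIGN (K2⁷ LINE 2⁰'s one bit)}.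

References (TYPES ∕ locators only): [I] = T. Bałaban, Commun. Math. Phys. **109** (1987) 249–301 [Balaban1987RG1]: Thm 3 p. 264, (1.20)–(1.22) p. 264, (2.12)–(2.14) p. 268,
§5 p. 298, (5.10) p. 293.
-/

noncomputable section

open Filter Topology
open scoped BigOperators NNReal

namespace YMDAG.N18.CornerBandOfKernelLetters

open Literature.MathematicalPhysics.QuantumFieldTheory.Balaban1983to89
open Literature.MathematicalPhysics.QuantumFieldTheory.Balaban1983to89.T4Continuum (T4Family ULoop)
open Literature.MathematicalPhysics.QuantumFieldTheory.Balaban1983to89.T4OutputRate (Window NE9)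
open Literature.MathematicalPhysics.QuantumFieldTheory.Balaban1983to89.FlowStep (Box HBeta mem_box prefixOf histBox_eq_box)
open Literature.MathematicalPhysics.QuantumFieldTheory.Balaban1983to89.B12Beta (HistBox)
open Literature.MathematicalPhysics.QuantumFieldTheory.Balaban1983to89.T4CouplingMatching (HistLipschitz FadingMemory)
open Literature.MathematicalPhysics.QuantumFieldTheory.Balaban1983to89.Node00 (TermFamily1 betaMerged betaOfMerged beta0OfMerged Beta0LimitExists
  tendsto_beta0OfMerged betaOfMerged_of_mem betaOfMerged_of_notMem mergedTermFamilyMatT TβOfRecord₁₃ TcanOfRecord chiβOfRecord₁₃ betaOfRecord₁₃ Stage13Params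
  Stage13HParams U3Letters₁₁ datumOfRecord₁₃CoPH)
open Literature.MathematicalPhysics.QuantumFieldTheory.Balaban1983to89.Node00.U3OfKernels (EA objectsOfRecord₁₃ KernelDecay KernelDecayOfRecord₁₃)
open Literature.MathematicalPhysics.QuantumFieldTheory.Balaban1983to89.B12Sec2to5 (betaPrime510)
open YMDAG.UVSplit (U3Carriers N22At ReadOutAt Datum RateReading₁₃CoPH rateCarriersOfRecord₁₃CoPH u3OfRecord₁₃)
open YMDAG.N22.AtKernels (histLipschitz_betaMerged_of_ne9 histLipschitz_betaOfMerged_of_ne9 fadingMemory_histModuli_of_fadingMemory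
  histLipschitz_betaOfRecord₁₃_of_kernelNE9 histLipschitz_fadingMemory_betaOfRecord₁₃_of_kernelNE9)
open YMDAG.N17.HistModuliCont (histLipschitz_of_readOutAt_n22)
open YMDAG.N18.Beta0LimitOfKernelLetters (exists_tendsto_nhdsGT_zero_of_lipschitzOnWith_Ioc update_last_mem_box beta0LimitExists_of_histLipschitz)
open YMDAG.N18.RemainderBandOfKernelLetters (betaPrime510_four_one_nonneg)

/-! ## §2 Generic term family at def-W1's kernel objects: kernel NE9 + one (5.10) clause (+ fading memory) ⇒ the corner numbers and the band for the merged β (N18 idle) -/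

section Kernels

variable {𝔄 : Type*} [NormedRing 𝔄] [NormedAlgebra ℝ 𝔄]
variable {V : Type*} [NormedAddCommGroup V] [NormedSpace ℝ V] {ι : Type*} [Fintype ι]
variable (F : T4Family) (ℰ : TermFamily1 F 𝔄) (ρ : V →L[ℝ] 𝔄) (bV : Module.Basis ι ℝ V)

/-- ★ **THE CORNER NUMBERS OF THE MERGED β OF A TERM FAMILY FROM KERNEL NE9 + ONE (5.10) CLAUSE** (dag-n22-w3's `histLipschitz_betaMerged_of_ne9` ∘ §1): `0 < γ`, `0 < κ`,
`NE9 (EA F ℰ ρ bV) (Window γ) κ Λ`, `KernelDecay F ℰ ρ bV (Window γ) 0 1 κ` ⟹ numbers `b_k = lim_{t→0⁺} betaMerged … k (t,…,t)` with the band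
`|betaMerged … k p − b_k| ≤ Σ_i |betaPrime510 4 1 κ·Λ (k+1) i|·p_i` on `]0, γ]^{k+1}`.  NO reference history.  LOCATED: both kernel inputs displayed. [cite: Balaban1987RG1, (1.20)-(1.22) p.264 and (5.10) p.293] -/
theorem exists_cornerNumbers_betaMerged_of_ne9 {γ κ : ℝ} {Λ : ℕ → ℕ → ℝ} (hγ : 0 < γ) (hκ : 0 < κ) (h9 : NE9 (EA F ℰ ρ bV) (Window γ) κ Λ)
    (hdec : KernelDecay F ℰ ρ bV (Window γ) 0 1 κ) :
    ∃ b : ℕ → ℝ, (∀ k : ℕ, Tendsto (fun t : ℝ => betaMerged F ℰ ρ bV k (fun _ : Fin (k + 1) => t)) (𝓝[>] (0 : ℝ)) (𝓝 (b k))) ∧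
      ∀ (k : ℕ) (p : Fin (k + 1) → ℝ), p ∈ Box γ k → |betaMerged F ℰ ρ bV k p - b k| ≤ ∑ i : Fin (k + 1), |betaPrime510 4 1 κ * Λ (k + 1) i| * p i :=
  exists_cornerNumbers_of_histLipschitz hγ (histLipschitz_betaMerged_of_ne9 F ℰ ρ bV hκ h9 hdec)

/-- **… AND UNDER NODE U3's FADING MEMORY THE BAND IS k-UNIFORM**: with `T4OutputRate.FadingMemory C₉ ω Λ` (`0 ≤ ω < 1`), any per-scale anchor `b` of the merged β (§1: the
corner numbers) has `|betaMerged … k p − b_k| ≤ betaPrime510 4 1 κ·C₉·ω·(1−ω)⁻¹·γ₀` on EVERY `]0, γ₀]^{k+1}`, `γ₀ ≤ γ` — DEF-1's `ConstRemainder` relative to the CORNER numbers, ONE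
constant, NO `hadm` (g3's `remainderConst_betaMerged_of_ne9_fadingMemory` is the v₀-referenced twin at radius `γ`). [cite: Balaban1987RG1, (1.20)-(1.22) p.264, §5 p.298 and (5.10) p.293] -/
theorem abs_betaMerged_sub_corner_le_band_of_ne9_fadingMemory {γ κ C₉ ω : ℝ} {Λ : ℕ → ℕ → ℝ} (hκ : 0 < κ) (h9 : NE9 (EA F ℰ ρ bV) (Window γ) κ Λ)
    (hΛ : T4OutputRate.FadingMemory C₉ ω Λ) (hω0 : 0 ≤ ω) (hω1 : ω < 1) (hdec : KernelDecay F ℰ ρ bV (Window γ) 0 1 κ) {b : ℕ → ℝ}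
    (hb : ∀ (k : ℕ) (δ : ℝ), 0 < δ → ∃ γ' : ℝ, 0 < γ' ∧ ∀ p : Fin (k + 1) → ℝ, p ∈ HistBox γ' k → |betaMerged F ℰ ρ bV k p - b k| ≤ δ)
    {γ₀ : ℝ} (hγ₀ : γ₀ ≤ γ) (k : ℕ) {p : Fin (k + 1) → ℝ} (hp : p ∈ HistBox γ₀ k) :
    |betaMerged F ℰ ρ bV k p - b k| ≤ betaPrime510 4 1 κ * C₉ * ω * (1 - ω)⁻¹ * γ₀ :=
  abs_sub_le_band_of_fadingMemory (abs_sub_le_sum_of_anchor_of_histLipschitz (histLipschitz_betaMerged_of_ne9 F ℰ ρ bV hκ h9 hdec) hb)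
    (fadingMemory_histModuli_of_fadingMemory (betaPrime510_four_one_nonneg κ) hΛ) hω0 hω1 hγ₀ k hp

end Kernels

/-! ## §3 At the record, Stage 13: the corner numbers of `betaOfRecord₁₃ F N θ` from K3⁷ v5 §2b (i)∕(iii)'s raw kernel inputs VERBATIM — NO admissibility row `hadm` -/

section Record

open scoped Matrix.Norms.L2Operator

variable (F : T4Family) (N : ℕ) [NeZero N]

/-- ★★ **THE CORNER NUMBERS OF THE β OF RECORD FROM N22's KERNEL NE9 + (D4)'s (5.10) CLAUSE OF RECORD** (dag-n22-w3's `histLipschitz_betaOfRecord₁₃_of_kernelNE9` ∘ §1): for a Stage-13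
parameter `θ` with `0 < θ.γ`, a letter block `ℓ`, `0 < κ`, kernel-currency NE9 of the functional of record (`(objectsOfRecord₁₃ F N θ ℓ).EA 0` — K3⁷ v5 §2b (i)'s `h9` VERBATIM) and the
(5.10) clause of record `KernelDecayOfRecord₁₃ F N θ 0 1 κ` (§2b (iii)'s `hdec` VERBATIM): numbers `b` with (a) `betaOfRecord₁₃ F N θ k (t,…,t) → b_k` as `t → 0⁺`; (b) the PER-SCALE
ANCHOR `∀ k δ>0 ∃ γ′>0 ∀ p ∈ HistBox γ′ k, |β k p − b k| ≤ δ` — VERBATIM the `hA` hypothesis of v5 §2b (ii′) `sensitive_rrOfRecord_of_pinned_of_anchor` ∕ §4 (iv)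
`betaOfRecord_eq_anchor_of_guardedReading_of_blind` (at `θ.toStage13Params`) and of K2⁷'s `ScaleAnchor` consumers, hence NOT an extra letter under the pin; (c) the linear band on
`]0, θ.γ]^{k+1}`.  NO `hadm`, no `θ.v₀`.  LOCATED: kernel inputs displayed, inhabited at no θ here; N22 ∕ (D4) NOT discharged. [cite: Balaban1987RG1, (1.20)-(1.22) p.264, (2.12)-(2.14) p.268 and (5.10) p.293] -/
theorem exists_cornerNumbers_betaOfRecord₁₃_of_kernelNE9 (θ : Stage13Params F N) (ℓ : U3Letters₁₁) {κ : ℝ} {Λ : ℕ → ℕ → ℝ} (hγ : 0 < θ.γ) (hκ : 0 < κ)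
    (h9 : NE9 ((objectsOfRecord₁₃ F N θ ℓ).EA 0) (Window θ.γ) κ Λ) (hdec : KernelDecayOfRecord₁₃ F N θ 0 1 κ) :
    ∃ b : ℕ → ℝ, (∀ k : ℕ, Tendsto (fun t : ℝ => betaOfRecord₁₃ F N θ k (fun _ : Fin (k + 1) => t)) (𝓝[>] (0 : ℝ)) (𝓝 (b k))) ∧
      (∀ (k : ℕ) (δ : ℝ), 0 < δ → ∃ γ' : ℝ, 0 < γ' ∧ ∀ p : Fin (k + 1) → ℝ, p ∈ HistBox γ' k → |betaOfRecord₁₃ F N θ k p - b k| ≤ δ) ∧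
      ∀ (k : ℕ) (p : Fin (k + 1) → ℝ), p ∈ Box θ.γ k → |betaOfRecord₁₃ F N θ k p - b k| ≤ ∑ i : Fin (k + 1), |betaPrime510 4 1 κ * Λ (k + 1) i| * p i := by
  obtain ⟨b, hT, hband⟩ := exists_cornerNumbers_of_histLipschitz hγ (histLipschitz_betaOfRecord₁₃_of_kernelNE9 F N θ ℓ hκ h9 hdec)
  exact ⟨b, hT, anchor_of_band (Λ := fun k i => betaPrime510 4 1 κ * Λ (k + 1) i) hγ hband, hband⟩

/-- ★★ **THE `hA` OF K3⁷ v5 §2b (ii′) ∕ §4 (iv) FROM §2b (i) + (iii)**: the β of record IS per-scale anchored at SOME sequence (its corner numbers) — so under the node-U3 pin the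
displayed anchor hypothesis of `sensitive_rrOfRecord_of_pinned_of_anchor` and `betaOfRecord_eq_anchor_of_guardedReading_of_blind` is a CONSEQUENCE of the N22 and (D4) kernel
letters the same section already displays; K2⁷'s corner road (PORT-1 `exists_scaleAnchor_of_histLipschitz`, idea-7) reads the same `b`.  LOCATED. [cite: Balaban1987RG1, (2.12)-(2.14) p.268 and (5.10) p.293] -/
theorem anchor_betaOfRecord₁₃_of_kernelNE9 (θ : Stage13Params F N) (ℓ : U3Letters₁₁) {κ : ℝ} {Λ : ℕ → ℕ → ℝ} (hγ : 0 < θ.γ) (hκ : 0 < κ)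
    (h9 : NE9 ((objectsOfRecord₁₃ F N θ ℓ).EA 0) (Window θ.γ) κ Λ) (hdec : KernelDecayOfRecord₁₃ F N θ 0 1 κ) :
    ∃ b : ℕ → ℝ, ∀ (k : ℕ) (δ : ℝ), 0 < δ → ∃ γ' : ℝ, 0 < γ' ∧ ∀ p : Fin (k + 1) → ℝ, p ∈ HistBox γ' k → |betaOfRecord₁₃ F N θ k p - b k| ≤ δ := by
  obtain ⟨b, -, hA, -⟩ := exists_cornerNumbers_betaOfRecord₁₃_of_kernelNE9 F N θ ℓ hγ hκ h9 hdec
  exact ⟨b, hA⟩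

/-- **LETTER-BLOCK EDITION, k-UNIFORM** (the K3⁷ v5 pin reads `ℓ : U3Letters₁₁`, N22's moduli `ℓ.moduli a i = ℓ.C₉·ℓ.ω^{a−i}`, signs `ℓ.Signs`): with `0 < ℓ.κ`, kernel NE9 at
`(ℓ.κ, ℓ.moduli)` and the (5.10) clause at `ℓ.κ`, any per-scale anchor `b` of the β of record (§3: its corner numbers) satisfies
`|betaOfRecord₁₃ F N θ k p − b_k| ≤ betaPrime510 4 1 ℓ.κ·ℓ.C₉·ℓ.ω·(1−ℓ.ω)⁻¹·γ₀` on EVERY `]0, γ₀]^{k+1}`, `γ₀ ≤ θ.γ`, UNIFORMLY IN `k` — DEF-1's `ConstRemainder (betaOfRecord₁₃ F N θ) b (…·γ₀) γ₀`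
relative to the corner numbers, with a remainder LINEAR in the box side (g3's `remainderConst_record_of_kernelNE9_letters`: the v₀-referenced O(θ.γ) band).  LOCATED.
[cite: Balaban1987RG1, (1.20)-(1.22) p.264, §5 p.298 and (5.10) p.293] -/
theorem abs_betaOfRecord₁₃_sub_corner_le_band_of_kernelNE9_letters (θ : Stage13Params F N) (ℓ : U3Letters₁₁) (hs : ℓ.Signs) (hκ : 0 < ℓ.κ)
    (h9 : NE9 ((objectsOfRecord₁₃ F N θ ℓ).EA 0) (Window θ.γ) ℓ.κ ℓ.moduli) (hdec : KernelDecayOfRecord₁₃ F N θ 0 1 ℓ.κ) {b : ℕ → ℝ}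
    (hb : ∀ (k : ℕ) (δ : ℝ), 0 < δ → ∃ γ' : ℝ, 0 < γ' ∧ ∀ p : Fin (k + 1) → ℝ, p ∈ HistBox γ' k → |betaOfRecord₁₃ F N θ k p - b k| ≤ δ)
    {γ₀ : ℝ} (hγ₀ : γ₀ ≤ θ.γ) (k : ℕ) {p : Fin (k + 1) → ℝ} (hp : p ∈ HistBox γ₀ k) :
    |betaOfRecord₁₃ F N θ k p - b k| ≤ betaPrime510 4 1 ℓ.κ * ℓ.C₉ * ℓ.ω * (1 - ℓ.ω)⁻¹ * γ₀ := by
  obtain ⟨hL, hF⟩ := histLipschitz_fadingMemory_betaOfRecord₁₃_of_kernelNE9 F N θ ℓ hs hκ h9 hdec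
  exact abs_sub_le_band_of_fadingMemory (abs_sub_le_sum_of_anchor_of_histLipschitz hL hb) hF hs.ω_nonneg hs.ω_lt_one hγ₀ k hp

/-- **THE CONSUMERS' (2.12) NUMBERS AT AN ADMISSIBLE `θ.v₀` VERSUS THE CORNER NUMBERS, AT THE RECORD**: with the letter block as above AND the admissibility row `hadm`
(g3's files), the `β⁰`-field of the record's definitional split — `beta0OfMerged (betaMerged F (mergedTermFamilyMatT F N (TcanOfRecord F N) (chiβOfRecord₁₃ F N θ) θ.εbg) θ.ρ8 θ.bV) θ.v₀`,
the object of the 32 `hlim`-consumers and of CRIT-2's p592695 — lies within `betaPrime510 4 1 ℓ.κ·ℓ.C₉·ℓ.ω·(1−ℓ.ω)⁻¹·θ.γ` of the corner numbers `b` of the β of record, for EVERY `k`.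
So inside the window the base-history choice costs O(θ.γ); at `θ.v₀ := 0` (the records of record, `Node00/Record12Numerics`) `hadm` fails and the `β⁰`-field is a junk `limUnder` —
the corner numbers are the `v₀`-free replacement.  LOCATED. [cite: Balaban1987RG1, (1.20)-(1.22) p.264, (2.12)-(2.14) p.268 and §5 p.298] -/
theorem abs_beta0OfMerged_record_sub_corner_le_of_kernelNE9_letters (θ : Stage13Params F N) (ℓ : U3Letters₁₁) (hs : ℓ.Signs) (hκ : 0 < ℓ.κ)
    (h9 : NE9 ((objectsOfRecord₁₃ F N θ ℓ).EA 0) (Window θ.γ) ℓ.κ ℓ.moduli) (hdec : KernelDecayOfRecord₁₃ F N θ 0 1 ℓ.κ) {b : ℕ → ℝ}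
    (hb : ∀ (k : ℕ) (δ : ℝ), 0 < δ → ∃ γ' : ℝ, 0 < γ' ∧ ∀ p : Fin (k + 1) → ℝ, p ∈ HistBox γ' k → |betaOfRecord₁₃ F N θ k p - b k| ≤ δ)
    (hadm : ∀ k i, 0 < θ.v₀ k i ∧ θ.v₀ k i ≤ θ.γ) (k : ℕ) :
    letI := θ.instVβ₁; letI := θ.instVβ₂; letI := θ.instιβ
    |beta0OfMerged (betaMerged F (mergedTermFamilyMatT F N (TcanOfRecord F N) (chiβOfRecord₁₃ F N θ) θ.εbg) θ.ρ8 θ.bV) θ.v₀ k - b k| ≤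
      betaPrime510 4 1 ℓ.κ * ℓ.C₉ * ℓ.ω * (1 - ℓ.ω)⁻¹ * θ.γ := by
  letI := θ.instVβ₁; letI := θ.instVβ₂; letI := θ.instιβ
  have hγ : 0 < θ.γ := (hadm 0 0).1.trans_le (hadm 0 0).2
  -- the β of record IS the merged β on the boxes: anchors transfer from `betaOfRecord₁₃` to `betaMerged …`
  have hb' := anchor_congr_box (β := betaOfRecord₁₃ F N θ)
    (β' := betaMerged F (mergedTermFamilyMatT F N (TcanOfRecord F N) (chiβOfRecord₁₃ F N θ) θ.εbg) θ.ρ8 θ.bV) hγ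
    (fun k p hp => (betaOfMerged_of_mem _ _ _ hp).symm) hb
  have hL := histLipschitz_betaMerged_of_ne9 F _ θ.ρ8 θ.bV hκ h9 hdec
  have hF := fadingMemory_histModuli_of_fadingMemory (Λ := ℓ.moduli) (betaPrime510_four_one_nonneg ℓ.κ) (fun a i _ => ⟨hs.moduli_nonneg a i, le_rfl⟩)
  refine (abs_beta0OfMerged_sub_anchor_le_of_histLipschitz hL hb' hadm k).trans ?_
  -- `Σ_{i<k} |Λ′ k i|·v₀ k i ≤ (Σ_{i≤k} |Λ′ k i|)·θ.γ ≤ C (1−ω)⁻¹ θ.γ`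
  have hS : ∑ i : Fin k, |betaPrime510 4 1 ℓ.κ * ℓ.moduli (k + 1) (Fin.castSucc i)| * θ.v₀ k (Fin.castSucc i) ≤
      (∑ i : Fin (k + 1), |betaPrime510 4 1 ℓ.κ * ℓ.moduli (k + 1) i|) * θ.γ := by
    rw [Fin.sum_univ_castSucc, add_mul, Finset.sum_mul]
    have hlast : 0 ≤ |betaPrime510 4 1 ℓ.κ * ℓ.moduli (k + 1) (Fin.last k)| * θ.γ := mul_nonneg (abs_nonneg _) hγ.le
    refine le_add_of_le_of_nonneg (Finset.sum_le_sum fun i _ => ?_) hlast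
    exact mul_le_mul_of_nonneg_left (hadm k _).2 (abs_nonneg _)
  refine hS.trans ?_
  exact mul_le_mul_of_nonneg_right (sum_abs_moduli_le_of_fadingMemory hF hs.ω_nonneg hs.ω_lt_one k) hγ.le

end Record

/-! ## §4 K3⁷ ∕ K4 currency: `ReadOutAt D u ∧ N22At u` at ANY node-U3 carriers ⇒ the datum's β is per-scale anchored at its corner numbers, with the band (N18 idle); at the bundle of record -/

section Carriers

open scoped Matrix.Norms.L2Operator

variable {N : ℕ} [NeZero N] {F : T4Family}

/-- ★★ **THE CORNER NUMBERS OF THE DATUM's β ⇐ (D4) ∧ N22 AT NODE U3's CARRIERS — N18 IDLE** (dag-n17-w3's `histLipschitz_of_readOutAt_n22` ∘ §1): from `ReadOutAt D u` (window clause,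
run A's `RepresentsA`, slice membership, read-out bound) and `N22At u` (its NE9 half), with `0 < u.γ`: numbers `b` with the diagonal limits, the PER-SCALE ANCHOR (DEF-1's `ScaleAnchor D.βfun b`
unfolded — the first input of K2⁷'s corner road) and the band `|D.βfun k p − b_k| ≤ Σ_i |u.cr·u.Λ (k+1) i|·p_i` on `]0, u.γ]^{k+1}`.  (D4) ∕ NE9 UNPRINTED — binders.
[cite: Balaban1987RG1, (1.20)-(1.22) p.264, (2.12)-(2.14) p.268 and §5 p.298] -/
theorem exists_cornerNumbers_βfun_of_readOutAt_n22 (D : Datum F N) {u : U3Carriers} (hγ : 0 < u.γ) (hD4 : ReadOutAt D u) (h22 : N22At u) :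
    ∃ b : ℕ → ℝ, (∀ k : ℕ, Tendsto (fun t : ℝ => D.βfun k (fun _ : Fin (k + 1) => t)) (𝓝[>] (0 : ℝ)) (𝓝 (b k))) ∧
      (∀ (k : ℕ) (δ : ℝ), 0 < δ → ∃ γ' : ℝ, 0 < γ' ∧ ∀ p : Fin (k + 1) → ℝ, p ∈ HistBox γ' k → |D.βfun k p - b k| ≤ δ) ∧
      ∀ (k : ℕ) (p : Fin (k + 1) → ℝ), p ∈ Box u.γ k → |D.βfun k p - b k| ≤ ∑ i : Fin (k + 1), |u.cr * u.Λ (k + 1) i| * p i := by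
  obtain ⟨b, hT, hband⟩ := exists_cornerNumbers_of_histLipschitz hγ (histLipschitz_of_readOutAt_n22 D hD4 h22)
  exact ⟨b, hT, anchor_of_band (Λ := fun k i => u.cr * u.Λ (k + 1) i) hγ hband, hband⟩

/-- **… WITH THE k-UNIFORM BAND FROM N22's FADING-MEMORY HALF** (`u.ω < 1`; `0 ≤ u.cr`, `0 ≤ u.ω` are rows of `ReadOutAt`): for any per-scale anchor `b` of `D.βfun`,
`|D.βfun k p − b_k| ≤ u.cr·u.C₉·u.ω·(1−u.ω)⁻¹·γ₀` on EVERY `]0, γ₀]^{k+1}`, `γ₀ ≤ u.γ` — DEF-1's `ConstRemainder D.βfun b (…·γ₀) γ₀`, corner-referenced, v₀-free (g3's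
`remainderConst_βfun_of_readOutAt_n22`: the v₀-referenced twin at radius `u.γ`). [cite: Balaban1987RG1, (2.12)-(2.14) p.268 and §5 p.298] -/
theorem abs_βfun_sub_corner_le_band_of_readOutAt_n22 (D : Datum F N) {u : U3Carriers} (hD4 : ReadOutAt D u) (h22 : N22At u) (hω : u.ω < 1) {b : ℕ → ℝ}
    (hb : ∀ (k : ℕ) (δ : ℝ), 0 < δ → ∃ γ' : ℝ, 0 < γ' ∧ ∀ p : Fin (k + 1) → ℝ, p ∈ HistBox γ' k → |D.βfun k p - b k| ≤ δ)
    {γ₀ : ℝ} (hγ₀ : γ₀ ≤ u.γ) (k : ℕ) {p : Fin (k + 1) → ℝ} (hp : p ∈ HistBox γ₀ k) :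
    |D.βfun k p - b k| ≤ u.cr * u.C₉ * u.ω * (1 - u.ω)⁻¹ * γ₀ := by
  have hcr : 0 ≤ u.cr := by
    obtain ⟨_, _, _, _, _, _, _, _, _, _, _, hcr, _, _, _, _, _⟩ := hD4
    exact hcr
  have hω0 : 0 ≤ u.ω := by
    obtain ⟨_, _, _, _, _, _, _, _, _, _, _, _, _, _, hω0, _, _⟩ := hD4
    exact hω0
  exact abs_sub_le_band_of_fadingMemory (abs_sub_le_sum_of_anchor_of_histLipschitz (histLipschitz_of_readOutAt_n22 D hD4 h22) hb)
    (fadingMemory_histModuli_of_fadingMemory hcr h22.2) hω0 hω hγ₀ k hp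

/-- ★★ **AT THE BUNDLE OF RECORD OF ANY STAGE-13 RATE READING** (K3⁷ v5's `rrOfRecord 𝔯 ksel` at ONE tuple `(F, θ, hP, g₀, os)` and ONE run length `k₀`; `PHolderD4 β D R`
contains `ReadOutAt D R.u3` and, inside `RatesHolderAt`, `N22At R.u3`): the (D4) and N22 conjuncts at the node-U3 bundle `(rateCarriersOfRecord₁₃CoPH 𝔯 F θ hP g₀ os k₀).u3` (window radius
`θ.γ`, `rfl`) make the β OF RECORD `betaOfRecord₁₃ F N θ.toStage13Params` (= the datum's `βfun`, `rfl`) PER-SCALE ANCHORED AT ITS CORNER NUMBERS, with the diagonal limits and the band —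
so under stub 1's body the first input of K2⁷'s corner road (`∃ b, ScaleAnchor …`) and K3⁷ §4 (iv)'s `hA` are NOT extra letters, and NO base history `θ.v₀` is read.  LOCATED: `ReadOutAt` ∕
`N22At` at the bundle displayed; `stub_rates13H` NOT proved. [cite: Balaban1987RG1, (1.20)-(1.22) p.264, (2.12)-(2.14) p.268 and §5 p.298] -/
theorem exists_cornerNumbers_betaOfRecord₁₃_of_readOutAt_n22_rateCarriersOfRecord₁₃CoPH (𝔯 : RateReading₁₃CoPH N) (θ : Stage13HParams F N)
    (hP : θ.Provisos₁₃CoPH F N) (g₀ : ℕ → ℝ) (os : List (ULoop F)) (k₀ : ℕ) (hγ : 0 < θ.γ)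
    (hD4 : ReadOutAt (datumOfRecord₁₃CoPH F N θ hP) (rateCarriersOfRecord₁₃CoPH 𝔯 F θ hP g₀ os k₀).u3)
    (h22 : N22At (rateCarriersOfRecord₁₃CoPH 𝔯 F θ hP g₀ os k₀).u3) :
    ∃ b : ℕ → ℝ, (∀ k : ℕ, Tendsto (fun t : ℝ => betaOfRecord₁₃ F N θ.toStage13Params k (fun _ : Fin (k + 1) => t)) (𝓝[>] (0 : ℝ)) (𝓝 (b k))) ∧
      (∀ (k : ℕ) (δ : ℝ), 0 < δ → ∃ γ' : ℝ, 0 < γ' ∧ ∀ p : Fin (k + 1) → ℝ, p ∈ HistBox γ' k → |betaOfRecord₁₃ F N θ.toStage13Params k p - b k| ≤ δ) ∧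
      ∀ (k : ℕ) (p : Fin (k + 1) → ℝ), p ∈ Box θ.γ k → |betaOfRecord₁₃ F N θ.toStage13Params k p - b k| ≤
        ∑ i : Fin (k + 1), |(rateCarriersOfRecord₁₃CoPH 𝔯 F θ hP g₀ os k₀).u3.cr * (rateCarriersOfRecord₁₃CoPH 𝔯 F θ hP g₀ os k₀).u3.Λ (k + 1) i| * p i :=
  exists_cornerNumbers_βfun_of_readOutAt_n22 (datumOfRecord₁₃CoPH F N θ hP) hγ hD4 h22

end Carriers

/-! ## §5 Served by name — an OFFER to the K1⁷ run-rows readers (generic `HBeta`; nothing K1-side imported, nothing registered): the β-rows of K1⁷ v6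
`stub_runRows13PWS` in BOX form from {a k-uniform corner band, a β-ceiling below the world's ceiling, an eventual FLOOR of the corner numbers} -/

section RunRows

variable {β : HBeta} {b : ℕ → ℝ} {γ : ℝ}

/-- Along a coupling sequence in `]0, γ₀]` up to `n`, every prefix of length `≤ n` is a `]0, γ₀]`-history. [folklore] -/
theorem prefixOf_mem_histBox {γ₀ : ℝ} {n : ℕ} {g : ℕ → ℝ} (hg : Step.InInterval γ₀ n g) {j : ℕ} (hj : j ≤ n) : prefixOf g j ∈ HistBox γ₀ j :=
  fun i => hg i ((Nat.lt_succ_iff.mp i.isLt).trans hj)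

/-- ★ **K1⁷'s β-RUN-ROWS FROM THE CORNER BAND, A CEILING AND THE CORNER FLOOR** (OFFER; BOX form — the run rows follow by DEF-1's `runConstRemainder_of_constRemainder`, prefixes of
in-window runs lying in the boxes).  If `β` has a corner band UNIFORM in the scale (`|β_k(p) − b_k| ≤ S·γ₀` on every `]0, γ₀]^{k+1}`, `γ₀ ≤ γ` — §1 under fading memory), a CEILING
`β ≤ U` on `]0, γ]` with `U < βup` (the world's ceiling row, N11's reader), and the corner numbers have an EVENTUAL FLOOR `b_k ≥ e > 0` for `k ≥ k₀` (the asymptotic-freedom SIGN of the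
corner values — K2⁷ LINE 2⁰'s one bit, PORT-1 p609637), then the β-rows of K1⁷ v6 `stub_runRows13PWS` hold at this `β` with the CORNER numbers as reference sequence:
`∃ b r γ₀ B M, 0 < γ₀ ∧ (box remainder r) ∧ (∀ k, b k ≤ B) ∧ B + r ≤ βup ∧ (partial sums ≥ −M along every ]0,γ₀]-sequence)` — `γ₀` shrunk so that `r = S γ₀ ≤ min (e, (βup − U)∕2)`;
`M := Σ_{j<k₀} |b_j − r|`; no drift VALUE, no named numbers, no base history.  HYPOTHESES displayed; nothing of Bałaban asserted; K1⁷ NOT served by registration — an offer in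
generic currency. [cite: Balaban1987RG1, Thm 3 p.264 and (2.12)-(2.14) p.268] -/
theorem runRows_of_band_floor_ceiling {S U βup e : ℝ} {k₀ : ℕ} (hγ : 0 < γ) (hS : 0 ≤ S)
    (hband : ∀ γ₀ : ℝ, 0 < γ₀ → γ₀ ≤ γ → ∀ (k : ℕ) (p : Fin (k + 1) → ℝ), p ∈ HistBox γ₀ k → |β k p - b k| ≤ S * γ₀)
    (hup : ∀ (k : ℕ) (p : Fin (k + 1) → ℝ), p ∈ Box γ k → β k p ≤ U) (hU : U < βup) (he : 0 < e) (hfloor : ∀ k, k₀ ≤ k → e ≤ b k) :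
    ∃ (b' : ℕ → ℝ) (r γ₀ B M : ℝ), 0 < γ₀ ∧ γ₀ ≤ γ ∧ (∀ (k : ℕ) (p : Fin (k + 1) → ℝ), p ∈ HistBox γ₀ k → |β k p - b' k| ≤ r) ∧ (∀ k, b' k ≤ B) ∧
      B + r ≤ βup ∧ ∀ (n : ℕ) (g : ℕ → ℝ), Step.InInterval γ₀ n g → ∀ k, k ≤ n → -M ≤ ∑ j ∈ Finset.Ico k n, β j (prefixOf g j) := by
  have hgap : 0 < βup - U := sub_pos.2 hU
  set γ₀ : ℝ := min γ (min (e / (S + 1)) ((βup - U) / (2 * (S + 1)))) with hγ₀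
  have hγ₀0 : 0 < γ₀ := lt_min hγ (lt_min (by positivity) (by positivity))
  have hγ₀γ : γ₀ ≤ γ := min_le_left _ _
  have hγ₀e : γ₀ ≤ e / (S + 1) := (min_le_right _ _).trans (min_le_left _ _)
  have hγ₀g : γ₀ ≤ (βup - U) / (2 * (S + 1)) := (min_le_right _ _).trans (min_le_right _ _)
  set r : ℝ := S * γ₀ with hr
  have hre : r ≤ e := by
    calc r ≤ S * (e / (S + 1)) := mul_le_mul_of_nonneg_left hγ₀e hS
      _ ≤ e := by rw [mul_div_assoc']; exact (div_le_iff₀ (by positivity)).mpr (by nlinarith)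
  have hrg : r ≤ (βup - U) / 2 := by
    calc r ≤ S * ((βup - U) / (2 * (S + 1))) := mul_le_mul_of_nonneg_left hγ₀g hS
      _ ≤ (βup - U) / 2 := by
          rw [mul_div_assoc']
          exact (div_le_iff₀ (by positivity)).mpr (by nlinarith)
  have hrow : ∀ (k : ℕ) (p : Fin (k + 1) → ℝ), p ∈ HistBox γ₀ k → |β k p - b k| ≤ r := hband γ₀ hγ₀0 hγ₀γ
  -- the reference sequence is bounded above by `U + r` (read at the constant history `γ₀`)
  have hbU : ∀ k, b k ≤ U + r := fun k => by
    have hp : (fun _ : Fin (k + 1) => γ₀) ∈ HistBox γ₀ k := fun _ => ⟨hγ₀0, le_rfl⟩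
    have h1 := (abs_sub_le_iff.1 (hrow k _ hp)).2
    have h2 := hup k _ (mem_box.2 fun _ => ⟨hγ₀0, hγ₀γ⟩)
    linarith
  set M : ℝ := ∑ j ∈ Finset.range k₀, |b j - r| with hM
  refine ⟨b, r, γ₀, U + r, M, hγ₀0, hγ₀γ, hrow, hbU, by linarith, fun n g hg k _ => ?_⟩
  -- termwise: `β_j ≥ b_j − r ≥ −f j` with `f j := 𝟙_{j<k₀} |b_j − r|`
  set f : ℕ → ℝ := fun j => if j < k₀ then |b j - r| else 0 with hf
  have hterm : ∀ j ∈ Finset.Ico k n, -f j ≤ β j (prefixOf g j) := fun j hj => by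
    have hjn : j ≤ n := (Finset.mem_Ico.1 hj).2.le
    have h1 := (abs_sub_le_iff.1 (hrow j _ (prefixOf_mem_histBox hg hjn))).2
    simp only [hf]
    split_ifs with hjk
    · have := neg_abs_le (b j - r)
      linarith
    · have := hfloor j (not_lt.1 hjk)
      linarith
  have hsumf : ∑ j ∈ Finset.Ico k n, f j ≤ M := by
    have hfilter : ∑ j ∈ Finset.Ico k n, f j = ∑ j ∈ (Finset.Ico k n).filter (· < k₀), |b j - r| := by
      rw [Finset.sum_filter]
    rw [hfilter]
    refine Finset.sum_le_sum_of_subset_of_nonneg (fun j hj => ?_) fun j _ _ => abs_nonneg _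
    exact Finset.mem_range.2 (Finset.mem_filter.1 hj).2
  calc -M ≤ -∑ j ∈ Finset.Ico k n, f j := neg_le_neg hsumf
    _ = ∑ j ∈ Finset.Ico k n, -f j := (Finset.sum_neg_distrib ..).symm
    _ ≤ ∑ j ∈ Finset.Ico k n, β j (prefixOf g j) := Finset.sum_le_sum hterm

end RunRows

end YMDAG.N18.CornerBandOfKernelLetters

end
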